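import Mathlib.Analysis.Calculus.Deriv.Mul
import Mathlib.Analysis.Calculus.Deriv.Prod
import Mathlib.Analysis.Calculus.MeanValue
import Mathlib.Topology.Algebra.Module.FiniteDimension
import Literature.NumberTheory.Automorphic.GKModulesOneParameter
import Literature.NumberTheory.Automorphic.Liu2021.LemD2AsPrinted
import Literature.RepresentationTheory.BorelWallach2000.UpqMaximalCompactExp
import HarnessLib

/-!
# `𝔨`-skew real forms on a `(𝔤, K)`-module are `K`-invariant; the Hermitian form of a compatible real form

Topic `NumberTheory/Automorphic`; namespace `Literature.NumberTheory.Automorphic`.  THEOREMS ONLY (no definition, no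
instance, no notation, no named fact, no `sorry`).  First half of the converse «six clauses ⇒ Borel–Wallach unitarity»
(★ `GKInfinitesimallyUnitary`: `IsInfUnitaryAlongP ρ𝔤` and the proved direction `isInfUnitaryAlongP_of_isInfUnitary`); the
second half, for `U(2,1)`, is `GKInfinitesimallyUnitaryConverse` (sub-goal (α) «six-clause bridge» of the floor's T1a line).

THE ARGUMENT (Borel–Wallach 0 §2.5 «`( , )` … invariant under `K` and (infinitesimally) invariant under `𝔤`», read backwards).
1. (§1, any linear real group `G`, any `(𝔤, K)`-module) **`𝔨`-skewness integrates to invariance under `exp 𝔨`**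
   (`IsGKModule.bilin_apply_expK_eq`): if `ρ𝔤 X` is skew for a real bilinear form `B` (`X ∈ 𝔨`), then
   `B(exp(tX) a, exp(tX) b) = B(a, b)`.  On the finite-dimensional `K`-span `W` of `a, b` (axiom `kFinite`; `W` is
   `ρ𝔤 X`-stable by ★ `apply_mem_of_expK_stable`) the coordinates of `t ↦ exp(tX) v` are differentiable with derivative the
   coordinates of `exp(tX) ρ𝔤(X) v` (★ `IsGKModule.hasDerivAt_coeff`), so `f(t) = B(exp(tX) a, exp(tX) b)` is differentiable;
   by the group law `f(s + t) = B(exp(sX) a′, exp(sX) b′)` with `a′ = exp(tX) a`, `b′ = exp(tX) b`, whose derivative at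
   `s = 0` is `B(X a′, b′) + B(a′, X b′) = 0`; hence `f′ ≡ 0` and `f` is constant (`is_const_of_deriv_eq_zero`).
2. (§1′) For `U(α, β)` every `k ∈ K = U(α) × U(β)` is an exponential (★ `upq_expK_surjective` — this is where CONNECTEDNESS
   of `K` enters), so such a `B` is `K`-invariant (`upq_bilin_apply_eq_of_skew`).
3. (§2) **The Hermitian form** `H(x, y) := B(x, y) + i B(ix, y)` of a real symmetric positive-definite `B` with
   `B(ia, b) = −B(a, ib)`, all `ρ𝔤(Y)` skew and all `ρK(k)` orthogonal, is a positive-definite Hermitian form with all of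
   `𝔤` skew-Hermitian and `K` unitary: ★ `Liu2021.LemD2.IsInfUnitary ρK ρ𝔤` (`isInfUnitary_of_bilinForm`).

## Main statements

* `IsGKModule.bilin_apply_expK_eq` (§1, general `G`); `upq_bilin_apply_eq_of_skew` (§1′, `U(α, β)`);
* `isInfUnitary_of_bilinForm` (§2, `U(α, β)`, `α β : Type`).

## Mathlib / Literature search

Tree: ★ `IsGKModule` (`kFinite`, `hasWeakDeriv`), ★ `IsGKModule.hasDerivAt_coeff` ∕ `apply_mem_of_expK_stable` ∕
`RealMatrixGroup.expK_add_smul` ∕ `expK_zero_smul` (`GKModulesOneParameter`), ★ `upq_exists_expK_eq` (`UpqMaximalCompactExp`),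
★ `Liu2021.LemD2.IsInfUnitary` (`Liu2021/LemD2AsPrinted`).  Mathlib: `HasDerivAt.clm_apply`, `hasDerivAt_pi`,
`ContinuousLinearMap.hasFDerivAt`, `LinearMap.toContinuousLinearMap`, `is_const_of_deriv_eq_zero`, `Submodule.exists_isCompl` ∕
`Submodule.projectionOnto`, `Module.finBasis`, `Fintype.linearCombination`, `LinearMap.mk₂'ₛₗ`, `Complex.coe_smul`.
Dedup: `rg "bilin_apply_expK|bilin_apply_eq_of_skew|isInfUnitary_of_bilinForm"` over `Literature/`, `Summits/` — no hits.

## References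

* A. Borel, N. Wallach, *Continuous Cohomology, Discrete Subgroups, and Representations of Reductive Groups*, 2nd ed., AMS
  (2000), Ch. 0 §2.5 p. 4 (unitary `(𝔤, K)`-modules: `(π(k)v, π(k)w) = (v, w)`, `(π(x)v, w) + (v, π(x)w) = 0`).
  [BorelWallach2000]
* A. W. Knapp, D. A. Vogan, *Cohomological Induction and Unitary Representations*, Princeton (1995), §I.4 (1.64)–(1.65)
  (the `(𝔤, K)` axioms; differentiating the `K`-action on `K`-finite vectors). [KnappVogan1995]
-/

-- Mathlib idiom (Mathlib/Algebra/Lie/OfAssociative.lean), as in ★ `GKModules` ∕ ★ `GKInfinitesimallyUnitary`: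
-- the associative algebras `Matrix n n ℂ` and `Module.End ℂ V` as Lie rings (commutator bracket).
attribute [local instance 100] LieRing.ofAssociativeRing

set_option autoImplicit false

noncomputable section

open scoped MatrixGroups Matrix ComplexConjugate

namespace Literature.NumberTheory.Automorphic

open Literature.RepresentationTheory Literature.RepresentationTheory.BorelWallach2000
open Literature.RepresentationTheory.KonnoKonno2007

/-! ## §1 `𝔨`-skewness integrates to `K`-invariance (any linear real group, any `(𝔤, K)`-module) -/

section Integrate

variable {A : Type*} [NormedCommRing A] [NormedAlgebra ℝ A] [NormedAlgebra ℚ A] [CompleteSpace A]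
  [StarRing A] [StarModule ℝ A] [ContinuousStar A] {N : Type*} [Fintype N] [DecidableEq N]
  {G : RealMatrixGroup A N}
  {V : Type*} [AddCommGroup V] [Module ℂ V]
  {ρK : Representation ℂ G.maximalCompact V} {ρ𝔤 : G.lie →ₗ⁅ℝ⁆ Module.End ℂ V}

/-- **`𝔨`-skewness integrates along one-parameter subgroups of `K`.**  In a `(𝔤, K)`-module `(ρK, ρ𝔤)` of a linear real
group `G`, let `B` be ANY real bilinear form on `V` and `X ∈ 𝔨` with `ρ𝔤 X` skew for `B`.  Then `B` is invariant under the
one-parameter group `exp(tX) ⊆ K`: `B(exp(tX) a, exp(tX) b) = B(a, b)`.  Proof: on the finite-dimensional `K`-span `W` of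
`a, b` (`kFinite`; `ρ𝔤 X`-stable), coordinates of `t ↦ exp(tX) v` are differentiable with derivative the coordinates of
`exp(tX) (ρ𝔤 X v)` (`hasDerivAt_coeff`); so `f(t) = B(exp(tX) a, exp(tX) b)` is differentiable, and by the group law its
derivative at `t` is the derivative at `0` of `s ↦ B(exp(sX) a′, exp(sX) b′)` (`a′ = exp(tX) a`, `b′ = exp(tX) b`), namely
`B(X a′, b′) + B(a′, X b′) = 0`; a function with zero derivative is constant.  (Knapp–Vogan (1.64)–(1.65) differentiate the
`K`-action on `K`-finite vectors; Borel–Wallach 0 §2.5 is the statement being reversed.)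
[cite: KnappVogan1995, §I.4 (1.64)–(1.65)] [cite: BorelWallach2000, Ch. 0 §2.5 (p. 4)] -/
theorem IsGKModule.bilin_apply_expK_eq (h : IsGKModule G ρK ρ𝔤) (B : V →ₗ[ℝ] V →ₗ[ℝ] ℝ) (X : G.compactLie)
    (hB : ∀ a b : V, B (ρ𝔤 (LieSubalgebra.inclusion G.compactLie_le_lie X) a) b =
      -B a (ρ𝔤 (LieSubalgebra.inclusion G.compactLie_le_lie X) b))
    (t : ℝ) (a b : V) :
    B (ρK (G.expK (t • X)) a) (ρK (G.expK (t • X)) b) = B a b := by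
  classical
  set T : Module.End ℂ V := ρ𝔤 (LieSubalgebra.inclusion G.compactLie_le_lie X)
  -- the finite-dimensional `K`-stable subspace through `a` and `b`
  set Wa : Submodule ℂ V := Submodule.span ℂ (Set.range fun k : G.maximalCompact ↦ ρK k a)
  set Wb : Submodule ℂ V := Submodule.span ℂ (Set.range fun k : G.maximalCompact ↦ ρK k b)
  set W : Submodule ℂ V := Wa ⊔ Wb
  haveI : FiniteDimensional ℂ Wa := h.kFinite a
  haveI : FiniteDimensional ℂ Wb := h.kFinite b
  haveI : FiniteDimensional ℂ W := Submodule.finiteDimensional_sup Wa Wb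
  have hspanK : ∀ (v : V) (k : G.maximalCompact),
      ∀ u ∈ Submodule.span ℂ (Set.range fun k' : G.maximalCompact ↦ ρK k' v),
        ρK k u ∈ Submodule.span ℂ (Set.range fun k' : G.maximalCompact ↦ ρK k' v) := by
    intro v k u hu
    refine Submodule.span_induction (p := fun u _ ↦ ρK k u ∈ _) ?_ ?_ ?_ ?_ hu
    · rintro _ ⟨k', rfl⟩
      refine Submodule.subset_span ⟨k * k', ?_⟩
      simp only [map_mul, Module.End.mul_apply]
    · simp only [map_zero, Submodule.zero_mem]
    · intro x y _ _ hx hy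
      simpa only [map_add] using Submodule.add_mem _ hx hy
    · intro c x _ hx
      simpa only [map_smul] using Submodule.smul_mem _ c hx
  have hWK : ∀ (k : G.maximalCompact), ∀ u ∈ W, ρK k u ∈ W := by
    intro k u hu
    obtain ⟨x, hx, y, hy, rfl⟩ := Submodule.mem_sup.1 hu
    rw [map_add]
    exact Submodule.add_mem_sup (hspanK a k x hx) (hspanK b k y hy)
  have haW : a ∈ W :=
    Submodule.mem_sup_left (Submodule.subset_span ⟨1, by simp only [map_one, Module.End.one_apply]⟩)
  have hbW : b ∈ W :=
    Submodule.mem_sup_right (Submodule.subset_span ⟨1, by simp only [map_one, Module.End.one_apply]⟩)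
  have hWT : ∀ u ∈ W, T u ∈ W := fun u hu ↦
    h.apply_mem_of_expK_stable X (fun s u hu ↦ hWK _ u hu) hu
  -- coordinates on `W`, extended to functionals on `V` along a complement
  obtain ⟨q, hq⟩ := W.exists_isCompl
  set P : V →ₗ[ℂ] W := W.projectionOnto q hq
  have hPW : ∀ (u : V) (hu : u ∈ W), P u = ⟨u, hu⟩ := fun u hu ↦
    Submodule.projectionOnto_apply_of_mem_left hq hu
  set bW := Module.finBasis ℂ W
  set ℓ : Fin (Module.finrank ℂ W) → Module.Dual ℂ V := fun i ↦ bW.coord i ∘ₗ P with hℓ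
  have hrec : ∀ u ∈ W, ∑ i, ℓ i u • (bW i : V) = u := by
    intro u hu
    have h1 := congrArg Subtype.val (bW.sum_repr ⟨u, hu⟩)
    rw [Submodule.coe_sum] at h1
    refine Eq.trans (Finset.sum_congr rfl fun i _ ↦ ?_) h1
    rw [Submodule.coe_smul]
    congr 1
    simp only [hℓ, LinearMap.coe_comp, Function.comp_apply, hPW u hu, Module.Basis.coord_apply]
  -- the real coordinate model `E = ℂ^n`, and `B` pulled back to it as a continuous bilinear map
  set L : (Fin (Module.finrank ℂ W) → ℂ) →ₗ[ℝ] V :=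
    (Fintype.linearCombination ℂ (fun i ↦ (bW i : V))).restrictScalars ℝ with hL
  have hLapp : ∀ x : Fin (Module.finrank ℂ W) → ℂ, L x = ∑ i, x i • (bW i : V) := fun x ↦ by
    rw [hL, LinearMap.restrictScalars_apply, Fintype.linearCombination_apply]
  set Bt : (Fin (Module.finrank ℂ W) → ℂ) →ₗ[ℝ] (Fin (Module.finrank ℂ W) → ℂ) →ₗ[ℝ] ℝ :=
    B.compl₁₂ L L
  set BL : (Fin (Module.finrank ℂ W) → ℂ) →L[ℝ] (Fin (Module.finrank ℂ W) → ℂ) →L[ℝ] ℝ :=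
    LinearMap.toContinuousLinearMap
      ((LinearMap.toContinuousLinearMap :
          ((Fin (Module.finrank ℂ W) → ℂ) →ₗ[ℝ] ℝ) ≃ₗ[ℝ] ((Fin (Module.finrank ℂ W) → ℂ) →L[ℝ] ℝ)).toLinearMap
        ∘ₗ Bt)
  have hBLapp : ∀ x y : Fin (Module.finrank ℂ W) → ℂ, BL x y = B (L x) (L y) := fun x y ↦ rfl
  -- the coordinate curves `γ v s = (ℓ i (exp(sX) v))_i` and their derivatives
  set γ : V → ℝ → (Fin (Module.finrank ℂ W) → ℂ) := fun v s i ↦ ℓ i (ρK (G.expK (s • X)) v)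
  have hγ' : ∀ (v : V) (s : ℝ), HasDerivAt (γ v) (fun i ↦ ℓ i (ρK (G.expK (s • X)) (T v))) s :=
    fun v s ↦ hasDerivAt_pi.2 fun i ↦ h.hasDerivAt_coeff X v (ℓ i) s
  have hLγ : ∀ v ∈ W, ∀ s : ℝ, L (γ v s) = ρK (G.expK (s • X)) v := fun v hv s ↦ by
    rw [hLapp]
    exact hrec _ (hWK _ v hv)
  -- derivative zero at `s = 0` for every pair of vectors of `W`
  have key : ∀ u ∈ W, ∀ w ∈ W,
      HasDerivAt (fun s : ℝ ↦ B (ρK (G.expK (s • X)) u) (ρK (G.expK (s • X)) w)) 0 0 := by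
    intro u hu w hw
    have h1 : HasDerivAt (fun s : ℝ ↦ BL (γ u s))
        (BL (fun i ↦ ℓ i (ρK (G.expK ((0 : ℝ) • X)) (T u)))) 0 :=
      (BL.hasFDerivAt).comp_hasDerivAt (0 : ℝ) (hγ' u 0)
    have h2 := h1.clm_apply (hγ' w 0)
    have hfun : (fun s : ℝ ↦ BL (γ u s) (γ w s)) =
        fun s : ℝ ↦ B (ρK (G.expK (s • X)) u) (ρK (G.expK (s • X)) w) := by
      funext s
      rw [hBLapp, hLγ u hu, hLγ w hw]
    rw [hfun] at h2
    refine h2.congr_deriv ?_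
    have hTu : L (fun i ↦ ℓ i (ρK (G.expK ((0 : ℝ) • X)) (T u))) = T u := by
      rw [hLapp]
      simp only [RealMatrixGroup.expK_zero_smul, map_one, Module.End.one_apply]
      exact hrec _ (hWT u hu)
    have hTw : L (fun i ↦ ℓ i (ρK (G.expK ((0 : ℝ) • X)) (T w))) = T w := by
      rw [hLapp]
      simp only [RealMatrixGroup.expK_zero_smul, map_one, Module.End.one_apply]
      exact hrec _ (hWT w hw)
    have hu0 : L (γ u 0) = u := by
      rw [hLγ u hu, RealMatrixGroup.expK_zero_smul, map_one, Module.End.one_apply]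
    have hw0 : L (γ w 0) = w := by
      rw [hLγ w hw, RealMatrixGroup.expK_zero_smul, map_one, Module.End.one_apply]
    rw [hBLapp, hBLapp, hTu, hTw, hu0, hw0, hB u w]
    ring
  -- derivative zero everywhere, by the group law
  set f : ℝ → ℝ := fun s ↦ B (ρK (G.expK (s • X)) a) (ρK (G.expK (s • X)) b) with hf
  have hderiv : ∀ t : ℝ, HasDerivAt f 0 t := by
    intro t
    have h0 := key _ (hWK (G.expK (t • X)) a haW) _ (hWK (G.expK (t • X)) b hbW)
    have h1 : HasDerivAt (fun s : ℝ ↦ f (s + t)) 0 0 := by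
      refine h0.congr_of_eventuallyEq (Filter.Eventually.of_forall fun s ↦ ?_)
      simp only [hf, RealMatrixGroup.expK_add_smul, map_mul, Module.End.mul_apply]
    have h2 := HasDerivAt.comp_sub_const (f := fun s : ℝ ↦ f (s + t)) t t (by rwa [sub_self])
    refine h2.congr_of_eventuallyEq (Filter.Eventually.of_forall fun s ↦ ?_)
    simp only [sub_add_cancel]
  have hconst : f t = f 0 :=
    is_const_of_deriv_eq_zero (fun s ↦ (hderiv s).differentiableAt) (fun s ↦ (hderiv s).deriv) t 0
  have hf0 : f 0 = B a b := by
    simp only [hf, RealMatrixGroup.expK_zero_smul, map_one, Module.End.one_apply]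
  have hft : f t = B (ρK (G.expK (t • X)) a) (ρK (G.expK (t • X)) b) := rfl
  rw [← hft, hconst, hf0]

end Integrate

/-! ## §1′ `U(α, β)`: `K = exp 𝔨`, so `𝔨`-skewness gives `K`-invariance -/

section Upq

variable {α β : Type*} [Fintype α] [DecidableEq α] [Fintype β] [DecidableEq β]
  {V : Type*} [AddCommGroup V] [Module ℂ V]
  {ρK : Representation ℂ (uFormGroup α β).maximalCompact V} {ρ𝔤 : (uFormGroup α β).lie →ₗ⁅ℝ⁆ Module.End ℂ V}

/-- **For `U(α, β)`, a real bilinear form for which `ρ𝔤(𝔨)` is skew is `K`-invariant** (`K = U(α) × U(β) = exp 𝔨`, ★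
`upq_exists_expK_eq`, and `IsGKModule.bilin_apply_expK_eq`).  This is where connectedness of `K` enters (Borel–Wallach 0 §2.5:
for connected `K` the `K`-condition follows from the `𝔨`-condition). [cite: BorelWallach2000, Ch. 0 §2.5 (p. 4)]
[cite: KnappVogan1995, §I.4 (1.64)–(1.65)] -/
theorem upq_bilin_apply_eq_of_skew (h : IsGKModule (uFormGroup α β) ρK ρ𝔤) (B : V →ₗ[ℝ] V →ₗ[ℝ] ℝ)
    (hB : ∀ (X : (uFormGroup α β).compactLie) (a b : V),
      B (ρ𝔤 (LieSubalgebra.inclusion (uFormGroup α β).compactLie_le_lie X) a) b =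
        -B a (ρ𝔤 (LieSubalgebra.inclusion (uFormGroup α β).compactLie_le_lie X) b))
    (k : (uFormGroup α β).maximalCompact) (a b : V) :
    B (ρK k a) (ρK k b) = B a b := by
  obtain ⟨X, rfl⟩ := upq_exists_expK_eq k
  have := h.bilin_apply_expK_eq B X (hB X) 1 a b
  rwa [one_smul] at this

end Upq

/-! ## §2 From the real form `B` to the Hermitian form `H(x, y) = B(x, y) + i B(ix, y)` -/

/-- **The Hermitian form of a compatible real form.**  Let `(ρK, ρ𝔤)` be a `K`-representation and a `𝔤`-action of `U(α, β)`
on `V`, and `B` a real bilinear form on `V`, symmetric, positive (`0 ≤ B(a,a)`), definite (`B(a,a) = 0 → a = 0`), with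
`B(ia, b) = −B(a, ib)`, for which every `ρ𝔤(Y)` (`Y ∈ 𝔤`) is skew and every `ρK(k)` (`k ∈ K`) is orthogonal.  Then
`H(x, y) := B(x, y) + i·B(ix, y)` is a positive-definite Hermitian form (conjugate-linear in `x`) for which all `ρ𝔤(Y)` are
skew-Hermitian and `K` is unitary, i.e. `(ρK, ρ𝔤)` is unitary in the printed sense of Borel–Wallach 0 §2.5
(★ `Liu2021.LemD2.IsInfUnitary`); `B = Re H`. [cite: BorelWallach2000, Ch. 0 §2.5 (p. 4)] -/
theorem isInfUnitary_of_bilinForm {α β : Type} [Fintype α] [DecidableEq α] [Fintype β] [DecidableEq β]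
    {V : Type*} [AddCommGroup V] [Module ℂ V]
    (ρK : Representation ℂ (uFormGroup α β).maximalCompact V) (ρ𝔤 : (uFormGroup α β).lie →ₗ⁅ℝ⁆ Module.End ℂ V)
    (B : V →ₗ[ℝ] V →ₗ[ℝ] ℝ) (hBs : ∀ a b, B a b = B b a) (hBp : ∀ a, 0 ≤ B a a)
    (hBd : ∀ a, B a a = 0 → a = 0) (hBI : ∀ a b, B (Complex.I • a) b = -B a (Complex.I • b))
    (hskew : ∀ (Y : (uFormGroup α β).lie) (a b : V), B (ρ𝔤 Y a) b = -B a (ρ𝔤 Y b))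
    (hK : ∀ (k : (uFormGroup α β).maximalCompact) (a b : V), B (ρK k a) (ρK k b) = B a b) :
    Liu2021.LemD2.IsInfUnitary ρK ρ𝔤 := by
  -- auxiliary identities for `B`
  have hs1 : ∀ (r : ℝ) (x y : V), B (r • x) y = r * B x y := fun r x y ↦ by
    rw [LinearMap.map_smul₂, smul_eq_mul]
  have hs2 : ∀ (r : ℝ) (x y : V), B x (r • y) = r * B x y := fun r x y ↦ by
    rw [map_smul (B x) r y, smul_eq_mul]
  have ha1 : ∀ (x x' y : V), B (x + x') y = B x y + B x' y := fun x x' y ↦ by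
    rw [LinearMap.map_add₂]
  have ha2 : ∀ (x y y' : V), B x (y + y') = B x y + B x y' := fun x y y' ↦ by
    rw [map_add]
  have hn1 : ∀ (x y : V), B (-x) y = -B x y := fun x y ↦ by
    rw [LinearMap.map_neg₂]
  have hIB : ∀ a b, B a (Complex.I • b) = -B (Complex.I • a) b := fun a b ↦ by rw [hBI, neg_neg]
  have hII : ∀ a b, B (Complex.I • a) (Complex.I • b) = B a b := fun a b ↦ by
    rw [hBI, smul_smul, Complex.I_mul_I, neg_one_smul, map_neg, neg_neg]
  have hre : ∀ (r : ℝ) (a : V), (r : ℂ) • a = r • a := fun r a ↦ Complex.coe_smul r a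
  have hdec : ∀ (c : ℂ) (y : V), c • y = (c.re : ℝ) • y + (c.im : ℝ) • (Complex.I • y) := by
    intro c y
    conv_lhs => rw [← Complex.re_add_im c]
    rw [add_smul, mul_smul, hre, hre]
  -- the candidate Hermitian form, as a bare function
  set Hf : V → V → ℂ := fun x y ↦ (B x y : ℂ) + Complex.I * (B (Complex.I • x) y : ℂ) with hHf
  have Hadd₁ : ∀ x x' y, Hf (x + x') y = Hf x y + Hf x' y := by
    intro x x' y
    simp only [hHf, smul_add, ha1]
    push_cast
    ring
  have Hadd₂ : ∀ x y y', Hf x (y + y') = Hf x y + Hf x y' := by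
    intro x y y'
    simp only [hHf, ha2]
    push_cast
    ring
  have Hsmul₂ : ∀ (c : ℂ) (x y : V), Hf x (c • y) = (RingHom.id ℂ) c • Hf x y := by
    intro c x y
    have e1 : B x (c • y) = c.re * B x y - c.im * B (Complex.I • x) y := by
      rw [hdec c y, ha2, hs2, hs2, hIB]
      ring
    have e2 : B (Complex.I • x) (c • y) = c.re * B (Complex.I • x) y + c.im * B x y := by
      rw [hdec c y, ha2, hs2, hs2, hII]
    simp only [hHf, RingHom.id_apply, smul_eq_mul, e1, e2]
    apply Complex.ext <;>
      simp only [Complex.add_re, Complex.add_im, Complex.mul_re, Complex.mul_im, Complex.ofReal_re,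
        Complex.ofReal_im, Complex.I_re, Complex.I_im] <;> ring
  have Hsmul₁ : ∀ (c : ℂ) (x y : V), Hf (c • x) y = (starRingEnd ℂ) c • Hf x y := by
    intro c x y
    have e1 : B (c • x) y = c.re * B x y + c.im * B (Complex.I • x) y := by
      rw [hdec c x, ha1, hs1, hs1]
    have e2 : B (Complex.I • (c • x)) y = c.re * B (Complex.I • x) y - c.im * B x y := by
      rw [smul_comm Complex.I c x, hdec c (Complex.I • x), smul_smul, Complex.I_mul_I, neg_one_smul, ha1, hs1,
        hs1, hn1]
      ring
    simp only [hHf, smul_eq_mul, e1, e2]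
    apply Complex.ext <;>
      simp only [Complex.add_re, Complex.add_im, Complex.mul_re, Complex.mul_im, Complex.ofReal_re,
        Complex.ofReal_im, Complex.I_re, Complex.I_im, Complex.conj_re, Complex.conj_im] <;> ring
  refine ⟨LinearMap.mk₂'ₛₗ (starRingEnd ℂ) (RingHom.id ℂ) Hf Hadd₁ Hsmul₁ Hadd₂ Hsmul₂, ?_, ?_, ?_, ?_⟩
  · -- Hermitian symmetry
    intro x y
    simp only [LinearMap.mk₂'ₛₗ_apply, hHf]
    rw [map_add, map_mul, Complex.conj_ofReal, Complex.conj_ofReal, Complex.conj_I, hBs y x, hBs (Complex.I • y) x,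
      hIB]
    push_cast
    ring
  · -- positivity
    intro x hx
    simp only [LinearMap.mk₂'ₛₗ_apply, hHf, Complex.add_re, Complex.ofReal_re, Complex.mul_re, Complex.I_re,
      Complex.I_im, Complex.ofReal_im, zero_mul, mul_zero, sub_zero, add_zero]
    exact lt_of_le_of_ne (hBp x) fun h0 ↦ hx (hBd x h0.symm)
  · -- every `ρ𝔤 Y` is skew-Hermitian
    intro Y x y
    simp only [LinearMap.mk₂'ₛₗ_apply, hHf]
    rw [← (ρ𝔤 Y).map_smul, hskew Y x y, hskew Y (Complex.I • x) y]
    push_cast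
    ring
  · -- `K` is unitary
    intro k x y
    simp only [LinearMap.mk₂'ₛₗ_apply, hHf]
    rw [← (ρK k).map_smul, hK k x y, hK k (Complex.I • x) y]

end Literature.NumberTheory.Automorphic

end
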